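import Summits.KontsevichZagierPeriods.KontsevichZagierPeriods.Theorems.GpcLegendreLemniscatic.Negative.Canonical
import Literature.NumberTheory.Transcendental.KZLogCalculusProofs

/-!
# `LegendreAllModuli` (stmt-KontsevichZagierPeriods-3523), line `Sketch`: stub `stub_halfLineTail` (M5)

The half-line tail of the line: inside the Kontsevich–Zagier move calculus
(`Literature/NumberTheory/Transcendental/KZCalculus.lean`) every representation
`a = [(0,∞), 1/(1 + y²)]` is equivalent to the canonical right-hand side
`arctanRep = [ℝ, 1/(2(1 + y²))]` of the crux. Writing `h = 1/(1 + y²)` and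
`P = [(0,∞), h/2]`, `N = [(−∞,0], h/2]`, `N° = [(−∞,0), h/2]`, `Z = [{0}, h/2]` for the
restrictions of `arctanRep` (`KZ.IntegralRep.restrict`; only their domains and integrands are used,
so the five relations are stated for arbitrary representations with these data), the relations are

* R1 `[arctanRep] − [N] − [P]` (rule 1a: `ℝ = (−∞,0] ∪ (0,∞)`, disjoint);
* R2 `[N] − [N°] − [Z]` (rule 1a: `(−∞,0] = (−∞,0) ∪ {0}`, disjoint);
* R3 `[Z]` (null domain: a point of `ℝ¹`);
* R4 `[N°] − [P]` (rule 2 along the reflection `y ↦ −y`, `|det| = 1`);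
* R5 `[a] − [P] − [P]` (rule 1b: `h = h/2 + h/2` on `(0,∞)`),

and `[a] − [arctanRep] = R5 − R1 − R2 − R3 − R4`.

No definitions are introduced. All auxiliary lemmas live in the sub-namespace
`…LegendreAllModuliLine.M5`; only the stub itself is declared in
`Summit.KontsevichZagierPeriods.UnfoldedStokes.LegendreAllModuliLine`.
Reference: Kontsevich–Zagier 2001, §1.2 rules (1)–(2).

-- adapted from Cruxes/GpcLegendreLemniscatic/DrefuteLineStubs.lean §C (drefute seat, stmt-0280)
-/

noncomputable section

open MeasureTheory Set
open Literature.NumberTheory.Transcendental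
open Literature.NumberTheory.Transcendental.KZ
open Literature.ModelTheory.ExponentialFields (IsSemialgebraic)
open MvPolynomial (X)
open Summit.KontsevichZagierPeriods.Grothendieck.GpcLegendreLemniscaticNegative

namespace Summit.KontsevichZagierPeriods.UnfoldedStokes.LegendreAllModuliLine

namespace M5

/-! ## The four pieces of the line `ℝ¹` are semialgebraic -/

/-- `(0,∞) ⊆ ℝ¹` is `ℚ`-semialgebraic (`0 < X 0`). [folklore] -/
theorem isSemialgebraic_posSet : IsSemialgebraic ℚ {y : Fin 1 → ℝ | 0 < y 0} := by
  simpa using Literature.ModelTheory.ExponentialFields.isSemialgebraic_setOf_eval_lt (k := ℚ)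
    (R := ℝ) (0 : MvPolynomial (Fin 1) ℚ) (X 0)

/-- `(−∞,0) ⊆ ℝ¹` is `ℚ`-semialgebraic (`X 0 < 0`). [folklore] -/
theorem isSemialgebraic_negSet : IsSemialgebraic ℚ {y : Fin 1 → ℝ | y 0 < 0} := by
  simpa using Literature.ModelTheory.ExponentialFields.isSemialgebraic_setOf_eval_lt (k := ℚ)
    (R := ℝ) (X 0 : MvPolynomial (Fin 1) ℚ) 0

/-- `(−∞,0] ⊆ ℝ¹` is `ℚ`-semialgebraic (`X 0 ≤ 0`). [folklore] -/
theorem isSemialgebraic_nonposSet : IsSemialgebraic ℚ {y : Fin 1 → ℝ | y 0 ≤ 0} := by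
  simpa using Literature.ModelTheory.ExponentialFields.isSemialgebraic_setOf_eval_le (k := ℚ)
    (R := ℝ) (X 0 : MvPolynomial (Fin 1) ℚ) 0

/-- `{0} ⊆ ℝ¹` is `ℚ`-semialgebraic (`X 0 = 0`). [folklore] -/
theorem isSemialgebraic_zeroSet : IsSemialgebraic ℚ {y : Fin 1 → ℝ | y 0 = 0} := by
  simpa using Literature.ModelTheory.ExponentialFields.isSemialgebraic_setOf_eval_eq_zero
    (k := ℚ) (R := ℝ) (X 0 : MvPolynomial (Fin 1) ℚ)

/-- The restriction `[σ, 1/(2(1+y²))]` of `arctanRep` to a semialgebraic `σ ⊆ ℝ¹` exists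
(`KZ.IntegralRep.restrict`). [cite: KontsevichZagier2001, §1.2 rules (1)–(2)] -/
theorem exists_halfRep (σ : Set (Fin 1 → ℝ)) (hσ : IsSemialgebraic ℚ σ) :
    ∃ r : IntegralRep 1, r.domain = σ ∧ r.integrand = fun x => 1 / (2 * (1 + x 0 ^ 2)) :=
  ⟨arctanRep.restrict σ hσ (subset_univ _), rfl, rfl⟩

/-! ## The five relations -/

/-- R1: `[arctanRep] − [N] − [P]` is a relation (rule 1a: `ℝ = (−∞,0] ∪ (0,∞)`, disjoint union).
[cite: KontsevichZagier2001, §1.2 rules (1)–(2)] -/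
theorem arctan_sub_N_sub_P_mem (N P : IntegralRep 1)
    (hNd : N.domain = {y | y 0 ≤ 0}) (hNi : N.integrand = fun x => 1 / (2 * (1 + x 0 ^ 2)))
    (hPd : P.domain = {y | 0 < y 0}) (hPi : P.integrand = fun x => 1 / (2 * (1 + x 0 ^ 2))) :
    of arctanRep - of N - of P ∈ relations := by
  apply domainAddRel_subset_relations
  refine ⟨1, arctanRep, N, P, ?_, ?_, ?_, ?_, rfl⟩
  · rw [hNd, hPd, arctanRep_domain]
    ext y
    simp only [mem_univ, true_iff, mem_union, mem_setOf_eq]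
    exact le_or_gt (y 0) 0
  · rw [hNd, hPd]
    have : ({y : Fin 1 → ℝ | y 0 ≤ 0} ∩ {y | 0 < y 0}) = ∅ := by
      ext y
      simp only [mem_inter_iff, mem_setOf_eq, mem_empty_iff_false, iff_false, not_and, not_lt]
      exact fun h => h
    rw [this, measure_empty]
  · intro x _
    rw [hNi, arctanRep_integrand]
  · intro x _
    rw [hPi, arctanRep_integrand]

/-- R2: `[N] − [N°] − [Z]` is a relation (rule 1a: `(−∞,0] = (−∞,0) ∪ {0}`, disjoint union).
[cite: KontsevichZagier2001, §1.2 rules (1)–(2)] -/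
theorem N_sub_No_sub_Z_mem (N No Z : IntegralRep 1)
    (hNd : N.domain = {y | y 0 ≤ 0}) (hNi : N.integrand = fun x => 1 / (2 * (1 + x 0 ^ 2)))
    (hNod : No.domain = {y | y 0 < 0}) (hNoi : No.integrand = fun x => 1 / (2 * (1 + x 0 ^ 2)))
    (hZd : Z.domain = {y | y 0 = 0}) (hZi : Z.integrand = fun x => 1 / (2 * (1 + x 0 ^ 2))) :
    of N - of No - of Z ∈ relations := by
  apply domainAddRel_subset_relations
  refine ⟨1, N, No, Z, ?_, ?_, ?_, ?_, rfl⟩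
  · rw [hNd, hNod, hZd]
    ext y
    simp only [mem_union, mem_setOf_eq]
    exact le_iff_lt_or_eq
  · rw [hNod, hZd]
    have : ({y : Fin 1 → ℝ | y 0 < 0} ∩ {y | y 0 = 0}) = ∅ := by
      ext y
      simp only [mem_inter_iff, mem_setOf_eq, mem_empty_iff_false, iff_false, not_and]
      intro h1 h2
      rw [h2] at h1
      exact lt_irrefl _ h1
    rw [this, measure_empty]
  · intro x _
    rw [hNi, hNoi]
  · intro x _
    rw [hNi, hZi]

/-- R3: `[Z]` is a relation (its domain, a point of `ℝ¹`, is null). [folklore] -/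
theorem Z_mem (Z : IntegralRep 1) (hZd : Z.domain = {y | y 0 = 0}) : of Z ∈ relations := by
  apply of_mem_relations_of_volume_eq_zero
  rw [hZd]
  exact volume_setOf_last_eq_zero (n := 0) 0

/-- R4: `[N°] − [P]` is a relation (rule 2 along the reflection `y ↦ −y` of `(−∞,0)` onto `(0,∞)`,
derivative `−id` with `|det| = 1`; the integrand `1/(2(1+y²))` is even).
[cite: KontsevichZagier2001, §1.2 rules (1)–(2)] -/
theorem No_sub_P_mem (No P : IntegralRep 1)
    (hNod : No.domain = {y | y 0 < 0}) (hNoi : No.integrand = fun x => 1 / (2 * (1 + x 0 ^ 2)))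
    (hPd : P.domain = {y | 0 < y 0}) (hPi : P.integrand = fun x => 1 / (2 * (1 + x 0 ^ 2))) :
    of No - of P ∈ relations := by
  apply changeOfVariablesRel_subset_relations
  set L : (Fin 1 → ℝ) →L[ℝ] (Fin 1 → ℝ) := ContinuousLinearMap.pi fun _ : Fin 1 =>
    -(ContinuousLinearMap.proj (R := ℝ) (φ := fun _ : Fin 1 => ℝ) 0) with hL
  refine ⟨1, No, P, fun y => -y, fun _ => L, ?_, ?_, ?_, ?_, ?_, rfl⟩
  · -- semialgebraic: the polynomial map `−X 0`
    rw [hNod]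
    refine (isSemialgebraicMapOn_aeval isSemialgebraic_negSet (fun _ : Fin 1 => -X 0)).congr ?_
    intro y _
    funext j
    fin_cases j
    simp
  · intro y _
    apply HasFDerivAt.hasFDerivWithinAt
    apply hasFDerivAt_pi''
    intro i
    fin_cases i
    simp only [hL, Fin.zero_eta, ContinuousLinearMap.proj_pi]
    exact (hasFDerivAt_apply (0 : Fin 1) y).fun_neg
  · exact neg_injective.injOn
  · rw [hPd, hNod, image_neg_eq_neg]
    ext y
    simp
  · intro y _
    have hdet : L.det = -1 := by
      show LinearMap.det ((L : (Fin 1 → ℝ) →L[ℝ] (Fin 1 → ℝ)) : (Fin 1 → ℝ) →ₗ[ℝ] (Fin 1 → ℝ)) = -1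
      rw [← LinearMap.det_toMatrix', Matrix.det_fin_one]
      simp [LinearMap.toMatrix'_apply, hL]
    rw [hdet, hNoi, hPi]
    show (1:ℝ) / (2 * (1 + y 0 ^ 2)) = 1 / (2 * (1 + ((-y) 0) ^ 2)) * |(-1:ℝ)|
    simp

/-- R5: `[a] − [P] − [P]` is a relation for every `a = [(0,∞), 1/(1+y²)]`
(rule 1b: `1/(1+y²) = h/2 + h/2`). [cite: KontsevichZagier2001, §1.2 rules (1)–(2)] -/
theorem a_sub_P_sub_P_mem (a P : IntegralRep 1) (had : a.domain = {y : Fin 1 → ℝ | 0 < y 0})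
    (hai : EqOn a.integrand (fun y => 1 / (1 + y 0 ^ 2)) {y : Fin 1 → ℝ | 0 < y 0})
    (hPd : P.domain = {y | 0 < y 0}) (hPi : P.integrand = fun x => 1 / (2 * (1 + x 0 ^ 2))) :
    of a - of P - of P ∈ relations := by
  apply integrandAddRel_subset_relations
  refine ⟨1, a, P, P, hPd.trans had.symm, hPd.trans had.symm, fun y hy => ?_, rfl⟩
  rw [had] at hy
  rw [hai hy, Pi.add_apply, hPi]
  have : (0:ℝ) < 1 + y 0 ^ 2 := by positivity
  field_simp
  ring

end M5

/-! ## Assembly: the stub -/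

/-- **M5, half-line to line**: `[(0,∞), 1/(1 + y²)] ~ [ℝ, 1/(2(1 + y²))] = arctanRep` by the
reflection `y ↦ −y` (rule 2), halving the integrand (rule 1b), `ℝ = (−∞,0] ∪ (0,∞)`,
`(−∞,0] = (−∞,0) ∪ {0}` (rule 1a) and the null point `{0}`:
`[a] − [arctanRep] = R5 − R1 − R2 − R3 − R4`. [cite: KontsevichZagier2001, §1.2 rules (1)–(2)] -/
theorem stub_halfLineTail :
    ∀ a : IntegralRep 1, a.domain = {y : Fin 1 → ℝ | 0 < y 0} →
      EqOn a.integrand (fun y => 1 / (1 + y 0 ^ 2)) {y : Fin 1 → ℝ | 0 < y 0} →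
      Equivalent a arctanRep := by
  intro a had hai
  obtain ⟨P, hPd, hPi⟩ := M5.exists_halfRep {y : Fin 1 → ℝ | 0 < y 0} M5.isSemialgebraic_posSet
  obtain ⟨N, hNd, hNi⟩ := M5.exists_halfRep {y : Fin 1 → ℝ | y 0 ≤ 0} M5.isSemialgebraic_nonposSet
  obtain ⟨No, hNod, hNoi⟩ := M5.exists_halfRep {y : Fin 1 → ℝ | y 0 < 0} M5.isSemialgebraic_negSet
  obtain ⟨Z, hZd, hZi⟩ := M5.exists_halfRep {y : Fin 1 → ℝ | y 0 = 0} M5.isSemialgebraic_zeroSet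
  have R1 := M5.arctan_sub_N_sub_P_mem N P hNd hNi hPd hPi
  have R2 := M5.N_sub_No_sub_Z_mem N No Z hNd hNi hNod hNoi hZd hZi
  have R3 := M5.Z_mem Z hZd
  have R4 := M5.No_sub_P_mem No P hNod hNoi hPd hPi
  have R5 := M5.a_sub_P_sub_P_mem a P had hai hPd hPi
  have : of a - of arctanRep =
      (of a - of P - of P) - (of arctanRep - of N - of P) - (of N - of No - of Z) - of Z
        - (of No - of P) := by
    abel
  show of a - of arctanRep ∈ relations
  rw [this]
  exact relations.sub_mem (relations.sub_mem (relations.sub_mem (relations.sub_mem R5 R1) R2) R3) R4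

end Summit.KontsevichZagierPeriods.UnfoldedStokes.LegendreAllModuliLine

end
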